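import Literature.NumberTheory.EllipticCurves.Jetchev2008.CoreVertices
import HarnessLib

/-!
# T1 JET (cell `bsd-jet`), road K, inputs `hcore` / `hB'A'` of the abstract Thm 6.3: the sign of a core
# vertex is selected by any non-zero eigenclass, and sign parts are monotone

HONEST FRAMING (programme file §HONESTY, verbatim): «no tranche here proves BSD; ARM L moves the
LITERAL column of an r ≤ 1 census into the kernel-proved-modulo-named-print column.» THEOREMS ONLY
(seat `bsd-jet-pv-2`, session g2; `--supports stmt-BirchSwinnertonDyer-14418`, helper); 0 classes
move. WHAT: two small inputs of the H63 assembly (`JET.Section6.tamagawaExponent_le_mInfty_of_minimalCoreVertex[_orderForm]`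
with `Core := Jetchev2008.IsGlobalCoreVertex`, sheet PV2-J6-KERNEL.ADDENDUM-2 §1(d)):
* `signPart_mono` — `H ≤ H' ⟹ H^{e} ≤ H'^{e}` (lit-ty's `Jetchev2008.signPart`): the inclusions
  `𝓗_{𝓕₀(c)}^{±} ≤ 𝓗_{𝓕(c)}^{±}` (`hB'A'`) from `𝓗_{𝓕₀(c)} ≤ 𝓗_{𝓕(c)}`.
* `isGlobalCoreVertex_sign_of_ne_zero` — at a core vertex ([J] print §5.2: «Inv H⁺ = (m), Inv H⁻ = ()
  or the mirror»), a NON-ZERO class in the `e`-part decides the sign: the `e`-part is cyclic of order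
  `p^m` and the `(−e)`-part is `0` — the first lines of the printed proof of Thm 5.2 («Since
  `m > m(c) = m_∞`, the class `κ_{c,m} ∈ 𝓗^{ε(c)}` is non-trivial, i.e. `𝓗^{ε(c)} ≅ ℤ/p^m` and
  `𝓗^{−ε(c)} = 0`», arXiv p0015:L56–58), giving `hcore : A' = ⊥`.
References: [cite: Jetchev2008, §5.2 and proof of Thm. 5.2 (p. 821) = arXiv §6.2, p0015 L38–L58].
-/

set_option autoImplicit false

noncomputable section

open scoped Classical

open WeierstrassCurve IsDedekindDomain NumberField Literature.NumberTheory.EllipticCurves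
  Literature.NumberTheory.EllipticCurves.Jetchev2008 Literature.NumberTheory.GaloisRepresentations

namespace Summit.BirchSwinnertonDyer.Rank1Residual.JET

variable (W : WeierstrassCurve ℚ) (K : Type) [Field K] [NumberField K] (ι : K →+* ℂ)

/-- Sign parts are monotone in the ambient subgroup: `H ≤ H' ⟹ H^{e} ≤ H'^{e}`. Elementary.
[cite: Jetchev2008, Lemma 3.4 (p. 816) (the inclusions of the lozenge diagrams)] -/
theorem signPart_mono (τ : K ≃ₐ[ℚ] K) (n e : ℤ)
    {H H' : AddSubgroup (galoisCohomology ((W.baseChange K).torsionGaloisModule n) 1)} (h : H ≤ H') :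
    signPart W K τ n e H ≤ signPart W K τ n e H' :=
  inf_le_inf_right _ h

/-- **The sign of a core vertex is decided by a non-zero eigenclass.** If `c` is a core vertex for
`m` (`Jetchev2008.IsGlobalCoreVertex`: `H⁺` cyclic of order `p^m` and `H⁻ = 0`, or the mirror, with
`H = H_{𝓕(c)}` at level `p^m`) and `x ≠ 0` lies in the `e`-part (`e = ±1`), then the `e`-part is cyclic
of order `p^m` and the `(−e)`-part is trivial — [J]'s first step in the proof of print Thm. 5.2.
[cite: Jetchev2008, proof of Thm. 5.2 (p. 821) = arXiv p0015 L56–L58; §5.2 (core vertex)] -/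
theorem isGlobalCoreVertex_sign_of_ne_zero (τ : K ≃ₐ[ℚ] K) (p m c : ℕ)
    [∀ k : ℕ, NumberField (ringClassField K ι k)]
    (hcore : IsGlobalCoreVertex W K ι τ p m c) {e : ℤ} (he : e = 1 ∨ e = -1)
    {x : galoisCohomology ((W.baseChange K).torsionGaloisModule ((p ^ m : ℕ) : ℤ)) 1}
    (hx : x ∈ signPart W K τ ((p ^ m : ℕ) : ℤ) e
      (modifiedSelmerGroup W K ι ((p ^ m : ℕ) : ℤ) c))
    (hx0 : x ≠ 0) :
    IsAddCyclic (signPart W K τ ((p ^ m : ℕ) : ℤ) e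
        (modifiedSelmerGroup W K ι ((p ^ m : ℕ) : ℤ) c)) ∧
      Nat.card (signPart W K τ ((p ^ m : ℕ) : ℤ) e
        (modifiedSelmerGroup W K ι ((p ^ m : ℕ) : ℤ) c)) = p ^ m ∧
      signPart W K τ ((p ^ m : ℕ) : ℤ) (-e)
        (modifiedSelmerGroup W K ι ((p ^ m : ℕ) : ℤ) c) = ⊥ := by
  -- the part containing `x ≠ 0` is not trivial
  have hne : signPart W K τ ((p ^ m : ℕ) : ℤ) e
      (modifiedSelmerGroup W K ι ((p ^ m : ℕ) : ℤ) c) ≠ ⊥ := by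
    intro h
    rw [h, AddSubgroup.mem_bot] at hx
    exact hx0 hx
  rcases he with rfl | rfl
  · rcases hcore with ⟨hcyc, hcard, hm⟩ | ⟨hbot, -, -⟩
    · exact ⟨hcyc, hcard, by simpa using hm⟩
    · exact absurd hbot hne
  · rcases hcore with ⟨-, -, hm⟩ | ⟨hbot, hcyc, hcard⟩
    · exact absurd hm hne
    · exact ⟨hcyc, hcard, by simpa using hbot⟩

end Summit.BirchSwinnertonDyer.Rank1Residual.JET

end
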